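import Summits.BirchSwinnertonDyer.BirchSwinnertonDyer.Theorems.CyclotomicUntwistNineClassesIndependent
import Summits.BirchSwinnertonDyer.BirchSwinnertonDyer.Theorems.CyclotomicUntwistNineGaloisDescent
import Summits.BirchSwinnertonDyer.BirchSwinnertonDyer.Theorems.CyclotomicUntwistDescendedFrobeniusOneModel
import Summits.BirchSwinnertonDyer.BirchSwinnertonDyer.Theorems.CyclotomicUntwistNineNamedFactOfKatzRank
import HarnessLib

/-!
# Route `CyclotomicUntwist`: `isDescendedFrobeniusMatrix_exists` ⟸ the PURE rank-`2` statement
# «`[η_W] ∈ span{[ω_W], φ[ω_W]}` in Katz's module of one supersingular good model» — `B ≠ 0`, model transport,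
# both independences, `ℚ₃`-rationality, `det/tr` and the power maps are ALL kernel

Cell `pub/bsd-wall` (D-0145 line `route-BirchSwinnertonDyer-CyclotomicUntwist`), prover seat `bsd-line-cycu-p5`
(gen 10), lane «the η-class is of the second kind», file 6 (assembly with the siblings' lanes). THEOREMS ONLY (no definition,
no named fact, no `sorry`); helper `--supports` K1 = stmt-BirchSwinnertonDyer-21580 (serves K2 = 21581 and C2 = 27549).
BSD is not proved by this file and no crux is; the named fact stays a named fact — this file says EXACTLY what it costs.

* §1 `classesIndependent_of_nineGoodModel`, `classesIndependent_of_psRow` — `ClassesIndependent` for EVERY good model of a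
  `W` admitting one supersingular good model (trace invariance `NineIntegers.specialFibreTrace_eq_of_nineGoodModel`), in
  particular for every good model of a principal-series row (`three_dvd_specialFibreTrace_of_psRow`): the independence
  clause of `IsDescendedFrobeniusMatrix` is DISCHARGED on the route's rows (cycu-p5 `classesIndependent_of_three_dvd_…`).
* §2 `ne_zero_of_etaPosition` — in an `η`-position `[η] ≡ A[ω] + B·φ[ω]` on a supersingular good model the coefficient
  `B` is AUTOMATICALLY non-zero (else `[η] ≡ A[ω]`, against §1).
* §3 **`isDescendedFrobeniusMatrix_exists_of_rankTwo`** — THE REDUCTION OF RECORD: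
  `(∀ W 𝓜 ρ, 3 ∣ a(𝓜,ρ) → ∃ A B : ℚ₃(ζ₉), HBD(classEta 𝓜 − A·classOmega 𝓜 − B·φ(classOmega 𝓜))) →
  isDescendedFrobeniusMatrix_exists`, composing cycu-p1's `NineGaloisDescent.isDescendedFrobeniusMatrix_exists_of_etaPosition`
  (Galois descent, `ω`-plane independence, Honda, det/tr), cycu-p4's `DescendedFrobeniusOneModel.hbd_omegaColumn_iff`
  (model transport) and §2. The hypothesis is Katz 1981 Thm 5.3.3 (`rank D(Ĝ/R) = height = 2`) read on the three classes
  `[ω], φ[ω], [η]` of ONE good model — the printed core, nothing else.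
* §4 **`isDescendedFrobeniusMatrix_exists_of_katzRank : katz_dieudonne_rank_le_two → isDescendedFrobeniusMatrix_exists`** —
  the two remaining hypotheses of cycu-p1's capstone `NineNamedFactOfKatzRank.isDescendedFrobeniusMatrix_exists_of_katzRankLeTwo`
  DISCHARGED: `secondKind_classEta` (`[η_W]` is of the second kind — log-type coefficients and bounded (indeed `u`·integral)
  coboundary, Parts I–III) and `not_hbd_classEta_sub_C_mul_classOmega` (`[η] ∉ ℚ₃(ζ₉)·[ω]`, §1). So the route's Literature
  named fact `WeierstrassCurve.isDescendedFrobeniusMatrix_exists` FOLLOWS from the single Literature named fact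
  `Literature.NumberTheory.EllipticCurves.katz_dieudonne_rank_le_two` (Katz 1981 Thm 5.3.3, special case) and nothing else.
[cite: Katz1981CrystallineDieudonne, Thm. 5.3.3 and Thm. 5.7.2] [cite: BerthelotOgus1983, Thm. (2.4) and Prop. (3.14)]
-/

set_option autoImplicit false
-- single-conjunct summit: `Summit.BirchSwinnertonDyer.BirchSwinnertonDyer.…` repeats the name by design
set_option linter.dupNamespace false

noncomputable section

open scoped Classical
open PowerSeries IsCyclotomicExtension Literature.NumberTheory.EllipticCurves.DescendedFrobenius
  Summit.BirchSwinnertonDyer.BirchSwinnertonDyer.Theorems.NineIntegers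
  Summit.BirchSwinnertonDyer.BirchSwinnertonDyer.Theorems.DescendedFrobeniusTransfer
  Summit.BirchSwinnertonDyer.BirchSwinnertonDyer.Theorems.NineDescendedFrobeniusOfOmegaColumn
  Summit.BirchSwinnertonDyer.BirchSwinnertonDyer.Theorems.NineClassesIndependent
  Summit.BirchSwinnertonDyer.BirchSwinnertonDyer.Theorems.NineHondaEstimate
  Summit.BirchSwinnertonDyer.BirchSwinnertonDyer.Theorems.NineHonda

namespace Summit.BirchSwinnertonDyer.BirchSwinnertonDyer.Theorems.NineRankTwoReduction

variable {W : WeierstrassCurve ℚ}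

/-! ## §1 `ClassesIndependent` on every good model, and on the principal-series rows -/

/-- **`ClassesIndependent` for EVERY good model** of a `W/ℚ` having one good model with supersingular special fibre
(the special-fibre trace is the same for all good models and all reduction maps). [cite: Katz1981CrystallineDieudonne, Thm. 5.7.2] -/
theorem classesIndependent_of_nineGoodModel (𝓜₀ : W.NineGoodModel) (ρ : ONine →+* ZMod 3)
    (hss : (3 : ℤ) ∣ 𝓜₀.specialFibreTrace ρ) (𝓜 : W.NineGoodModel) : 𝓜.ClassesIndependent := by
  haveI := isElliptic_of_nineGoodModel 𝓜₀
  refine classesIndependent_of_three_dvd_specialFibreTrace 𝓜 ρ ?_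
  rw [specialFibreTrace_eq_of_nineGoodModel 𝓜 𝓜₀ ρ]
  exact hss

/-- **`ClassesIndependent` on the principal-series rows**: for `W/ℚ` elliptic and globally minimal with `ClassO6 W 3`,
`v₃Δ_min` even and `Δ_min/3^v ≡ 1 (mod 3)`, EVERY good model over `𝓞_{ℚ₃(ζ₉)}` has independent classes `[ω_W], [η_W]`
(every good model of such a row is supersingular, `three_dvd_specialFibreTrace_of_psRow`). [cite: Katz1981CrystallineDieudonne, Thm. 5.7.2]
[cite: Kraus1990, Théorème (p = 3)] -/
theorem classesIndependent_of_psRow (W : WeierstrassCurve ℚ) [W.IsElliptic] [W.IsGloballyMinimal]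
    (hO6 : Summit.BirchSwinnertonDyer.Rank1Residual.Additive.ClassO6 W 3)
    (hev : Even (padicValInt 3 W.minimalDiscriminantInt))
    (hsq : W.minimalDiscriminantInt / 3 ^ padicValInt 3 W.minimalDiscriminantInt % 3 = 1)
    (𝓜 : W.NineGoodModel) : 𝓜.ClassesIndependent := by
  obtain ⟨ρ⟩ := nonempty_residueMap
  exact classesIndependent_of_three_dvd_specialFibreTrace 𝓜 ρ (three_dvd_specialFibreTrace_of_psRow W hO6 hev hsq 𝓜 ρ).1

/-! ## §2 In an `η`-position the `φ[ω]`-coefficient is non-zero -/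

/-- **`B ≠ 0` is automatic**: if `[η] ≡ A[ω] + B·φ[ω]` modulo bounded denominators on a good model with supersingular
special fibre, then `B ≠ 0` (otherwise `(−A)·[ω] + 1·[η]` would have bounded denominators, contradicting
`ClassesIndependent`). [cite: Katz1981CrystallineDieudonne, Thm. 5.7.2] -/
theorem ne_zero_of_etaPosition (𝓜 : W.NineGoodModel) (ρ : ONine →+* ZMod 3) (hss : (3 : ℤ) ∣ 𝓜.specialFibreTrace ρ)
    {A B : KNine} (hη : HasBoundedDenominators (𝓜.classEta - PowerSeries.C A * 𝓜.classOmega -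
      PowerSeries.C B * expand 3 (by norm_num) 𝓜.classOmega)) : B ≠ 0 := by
  intro hB
  have hI := classesIndependent_of_three_dvd_specialFibreTrace 𝓜 ρ hss
  have h : HasBoundedDenominators ((-A) • 𝓜.classOmega + (1 : KNine) • 𝓜.classEta) := by
    rw [smul_eq_C_mul, smul_eq_C_mul]
    have e : PowerSeries.C (-A) * 𝓜.classOmega + PowerSeries.C (1 : KNine) * 𝓜.classEta =
        𝓜.classEta - PowerSeries.C A * 𝓜.classOmega - PowerSeries.C B * expand 3 (by norm_num) 𝓜.classOmega := by
      rw [hB, map_zero, map_neg, map_one]; ring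
    rw [e]; exact hη
  exact one_ne_zero (hI _ _ h).2

/-! ## §3 The named fact from the pure rank-`2` statement -/

/-- **`isDescendedFrobeniusMatrix_exists` ⟸ RANK `2`.** If on every good model over `𝓞_{ℚ₃(ζ₉)}` with supersingular special
fibre the class `[η_W]` lies in the `ℚ₃(ζ₉)`-span of `[ω_W]` and `φ[ω_W] = [ω_W](z³)` modulo series with bounded denominators
(Katz 1981 Thm 5.3.3: `D(Ê/𝓞) ⊗ ℚ` has rank `2` = height, so the three classes are dependent; with `[ω], φ[ω]` independent
— a kernel theorem, `NineGaloisDescent.omegaPlane_independent` — this is the dependence), then the Literature named fact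
`WeierstrassCurve.isDescendedFrobeniusMatrix_exists` holds. Everything else is kernel: `B ≠ 0` (§2), transport between good
models (cycu-p4 `hbd_omegaColumn_iff`), `ℚ₃`-rationality and the `ω`-plane independence (cycu-p1, Galois descent + Honda),
`ClassesIndependent` (cycu-p5), `det = 3`, `tr = a`, the power maps `z⁹, z²⁷` (cycu-p1/p3).
[cite: Katz1981CrystallineDieudonne, Thm. 5.3.3] [cite: BerthelotOgus1983, Thm. (2.4) and Prop. (3.14)] -/
theorem isDescendedFrobeniusMatrix_exists_of_rankTwo
    (hH : ∀ (W : WeierstrassCurve ℚ) (𝓜 : W.NineGoodModel) (ρ : ONine →+* ZMod 3),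
      (3 : ℤ) ∣ 𝓜.specialFibreTrace ρ →
        ∃ A B : KNine, HasBoundedDenominators (𝓜.classEta - PowerSeries.C A * 𝓜.classOmega -
          PowerSeries.C B * expand 3 (by norm_num) 𝓜.classOmega)) :
    WeierstrassCurve.isDescendedFrobeniusMatrix_exists := by
  refine NineGaloisDescent.isDescendedFrobeniusMatrix_exists_of_etaPosition ?_ ?_
  · intro W 𝓜₁ 𝓜₂ c d h
    have h' := (DescendedFrobeniusOneModel.hbd_omegaColumn_iff 𝓜₂ 𝓜₁ 1 c d).mp (by simpa using h)
    simpa using h'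
  · intro W 𝓜 ρ hss
    obtain ⟨A, B, hη⟩ := hH W 𝓜 ρ hss
    exact ⟨A, B, ne_zero_of_etaPosition 𝓜 ρ hss hη, hη⟩

/-! ## §4 The named fact from Katz's rank theorem ALONE -/

/-- `n·[zⁿ]L_η ∈ 𝓞` for a model over `𝓞` (`[zⁿ⁺¹]L_η = P_{n+2}/(n+1)`, `P = z²x·ω` has `𝓞`-coefficients:
`ω = formalInvDiff ⊗ 1`). [cite: Katz1981CrystallineDieudonne, Lemma 5.1.2] -/
theorem natCast_mul_coeff_formalEtaIntegral_mem (E : WeierstrassCurve ONine) (n : ℕ) :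
    (n : KNine) * coeff n (E.map (algebraMap ONine KNine)).formalEtaIntegral ∈ ONine := by
  set ι := algebraMap ONine KNine with hι
  set 𝓔 := E.map ι with h𝓔
  have hP : 𝓔.formalXMulSq * 𝓔.formalOmega = (E.formalXMulSq * E.formalInvDiff).map ι := by
    rw [map_mul, WeierstrassCurve.map_formalXMulSq, WeierstrassCurve.map_formalInvDiff, ← h𝓔,
      WeierstrassCurve.formalInvDiff_eq_formalOmega]
  rcases n with _ | m
  · simp
  · rw [𝓔.coeff_succ_formalEtaIntegral m, hP, ← mul_assoc,
      show ((m + 1 : ℕ) : KNine) * algebraMap ℚ KNine (1 / (m + 1 : ℚ)) = 1 by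
        rw [show ((m + 1 : ℕ) : KNine) = algebraMap ℚ KNine (m + 1 : ℚ) by push_cast; simp, ← map_mul,
          mul_one_div_cancel (by positivity), map_one], one_mul]
    exact coeff_map_mem _ _

/-- **`[η_W] = classEta 𝓜` is of the second kind** in the spelling of `katz_dieudonne_rank_le_two`: log-type coefficients
with bounded denominators and a coboundary with bounded denominators (indeed `u · (𝓞-series)`, `coboundary_classEta`).
[cite: Katz1981CrystallineDieudonne, §5.1 (p. 193), Lemma 5.1.2] -/
theorem secondKind_classEta (𝓜 : W.NineGoodModel) :
    (∃ d : ℕ, ∀ n : ℕ, IsIntegral ℤ_[3] ((3 : KNine) ^ d * ((n : KNine) * coeff n 𝓜.classEta))) ∧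
      (∃ d' : ℕ, ∀ e : Fin 2 →₀ ℕ, IsIntegral ℤ_[3] ((3 : KNine) ^ d' * MvPowerSeries.coeff e
        (𝓜.classEta.subst (𝓜.E.map (algebraMap ONine KNine)).formalGroupLaw -
          𝓜.classEta.subst (MvPowerSeries.X 0) - 𝓜.classEta.subst (MvPowerSeries.X 1)))) := by
  set u : KNine := (𝓜.C.u : KNine) with hu
  set v : KNine := 𝓜.C.r * ((𝓜.C.u⁻¹ : KNineˣ) : KNine) with hv
  obtain ⟨k₁, hk₁⟩ := exists_three_pow_mul_isIntegral u
  obtain ⟨k₂, hk₂⟩ := exists_three_pow_mul_isIntegral v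
  have h3 : ∀ k : ℕ, IsIntegral ℤ_[3] ((3 : KNine) ^ k) := fun k => by
    have : (3 : KNine) = algebraMap ℤ_[3] KNine 3 := by rw [map_ofNat]
    rw [this, ← map_pow]; exact isIntegral_algebraMap
  refine ⟨⟨k₁ + k₂, fun n => ?_⟩, ⟨k₁, fun e => ?_⟩⟩
  · have e : (3 : KNine) ^ (k₁ + k₂) * ((n : KNine) * coeff n 𝓜.classEta) =
        (3 : KNine) ^ k₂ * ((3 : KNine) ^ k₁ * u) * ((n : KNine) * coeff n 𝓜.curve.formalEtaIntegral) +
          (3 : KNine) ^ k₁ * ((3 : KNine) ^ k₂ * v) * ((n : KNine) * coeff n 𝓜.curve.formalLog) := by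
      rw [WeierstrassCurve.NineGoodModel.classEta, map_add, PowerSeries.coeff_smul, PowerSeries.coeff_smul, smul_eq_mul,
        smul_eq_mul, ← hu, ← hv, pow_add]
      ring
    rw [e]
    exact (((h3 k₂).mul hk₁).mul (natCast_mul_coeff_formalEtaIntegral_mem 𝓜.E n)).add
      (((h3 k₁).mul hk₂).mul (natCast_mul_coeff_formalLog_mem 𝓜.E n))
  · have hcob := FormalEtaCoboundary.coboundary_classEta 𝓜
    unfold WeierstrassCurve.NineGoodModel.curve at hcob
    rw [hcob, MvPowerSeries.coeff_C_mul, ← mul_assoc, MvPowerSeries.coeff_map, ← hu]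
    exact hk₁.mul (Subtype.prop _)

/-- **`[η_W] ∉ ℚ₃(ζ₉)·[ω_W]`** on a good model with supersingular special fibre (special case of §1/`ClassesIndependent`).
[cite: Katz1981CrystallineDieudonne, Thm. 5.7.2] -/
theorem not_hbd_classEta_sub_C_mul_classOmega (𝓜 : W.NineGoodModel) (ρ : ONine →+* ZMod 3)
    (hss : (3 : ℤ) ∣ 𝓜.specialFibreTrace ρ) (c : KNine) :
    ¬ HasBoundedDenominators (𝓜.classEta - PowerSeries.C c * 𝓜.classOmega) := by
  intro h
  have hI := classesIndependent_of_three_dvd_specialFibreTrace 𝓜 ρ hss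
  have h' : HasBoundedDenominators ((-c) • 𝓜.classOmega + (1 : KNine) • 𝓜.classEta) := by
    rw [smul_eq_C_mul, smul_eq_C_mul, map_neg, map_one]
    have e : -PowerSeries.C c * 𝓜.classOmega + 1 * 𝓜.classEta = 𝓜.classEta - PowerSeries.C c * 𝓜.classOmega := by ring
    rw [e]; exact h
  exact one_ne_zero (hI _ _ h').2

/-- **THE NAMED FACT FROM KATZ'S RANK THEOREM ALONE:
`katz_dieudonne_rank_le_two → WeierstrassCurve.isDescendedFrobeniusMatrix_exists`.** cycu-p1's capstone
`isDescendedFrobeniusMatrix_exists_of_katzRankLeTwo` with its two `η`-hypotheses discharged (`secondKind_classEta`,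
`not_hbd_classEta_sub_C_mul_classOmega`): the route's existence fact for THE descended Frobenius matrix (Berthelot–Ogus + Katz,
formerly cite-only) reduces to the single printed statement «Katz's module of a good model over `𝓞_{ℚ₃(ζ₉)}` has rank ≤ 2»
(Katz 1981 Thm 5.3.3); det `= 3`, trace `= a`, `M₁₀ ≠ 0`, the power maps, both independences, `ℚ₃`-rationality, model transport
and the second-kindness of `[ω], φ[ω], [η]` are kernel theorems of the `cycu` seats p1–p5.
[cite: Katz1981CrystallineDieudonne, Thm. 5.3.3] [cite: BerthelotOgus1983, Thm. (2.4) and Prop. (3.14)] -/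
theorem isDescendedFrobeniusMatrix_exists_of_katzRank
    (hK : Literature.NumberTheory.EllipticCurves.katz_dieudonne_rank_le_two) :
    WeierstrassCurve.isDescendedFrobeniusMatrix_exists :=
  NineNamedFactOfKatzRank.isDescendedFrobeniusMatrix_exists_of_katzRankLeTwo hK
    (fun _ 𝓜 _ _ => secondKind_classEta 𝓜) (fun _ 𝓜 ρ hss c => not_hbd_classEta_sub_C_mul_classOmega 𝓜 ρ hss c)

/-- The same from the SUPERSINGULAR-restricted rank statement (the binder form cycu-p4's `H3 → …` lane produces).
[cite: Katz1981CrystallineDieudonne, Thm. 5.3.3] -/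
theorem isDescendedFrobeniusMatrix_exists_of_katzRank_supersingular
    (hK : ∀ (E : WeierstrassCurve ONine) (ρ : ONine →+* ZMod 3), IsUnit (E.map ρ).Δ →
      (3 : ℤ) ∣ Literature.NumberTheory.EllipticCurves.HasseManin.tr (E.map ρ) →
      ∀ f : Fin 3 → KNine⟦X⟧,
        (∀ i, constantCoeff (f i) = 0 ∧
          (∃ d : ℕ, ∀ n : ℕ, IsIntegral ℤ_[3] ((3 : KNine) ^ d * ((n : KNine) * coeff n (f i)))) ∧
          (∃ d' : ℕ, ∀ e : Fin 2 →₀ ℕ, IsIntegral ℤ_[3] ((3 : KNine) ^ d' * MvPowerSeries.coeff e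
            ((f i).subst (E.map (algebraMap ONine KNine)).formalGroupLaw - (f i).subst (MvPowerSeries.X 0) -
              (f i).subst (MvPowerSeries.X 1))))) →
        ∃ a : Fin 3 → KNine, a ≠ 0 ∧ HasBoundedDenominators (∑ i, PowerSeries.C (a i) * f i)) :
    WeierstrassCurve.isDescendedFrobeniusMatrix_exists :=
  NineNamedFactOfKatzRank.isDescendedFrobeniusMatrix_exists_of_katzRankLeTwo_supersingular hK
    (fun _ 𝓜 _ _ => secondKind_classEta 𝓜) (fun _ 𝓜 ρ hss c => not_hbd_classEta_sub_C_mul_classOmega 𝓜 ρ hss c)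

end Summit.BirchSwinnertonDyer.BirchSwinnertonDyer.Theorems.NineRankTwoReduction

end
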